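import Literature.Probability.RandomPlanarGeometry.HullSubordination
import Literature.Probability.RandomPlanarGeometry.HullExhaustion
import Literature.Analysis.Complex.Montel
import Literature.Analysis.Complex.Hurwitz
import Literature.Analysis.Complex.RiemannMapping
import Mathlib.Analysis.Complex.OpenMapping
import HarnessLib

/-!
# Continuity of `Φ'_A(0)` under kernel convergence — the named fact `tendsto_of_kernel` PROVED

G. F. Lawler, O. Schramm, W. Werner, *Conformal restriction: the chordal case*, J. Amer. Math.
Soc. **16** (2003) 917–955, arXiv:math/0209343 (**[LSW]**), proof of Lemma 3.5 (p. 12): "It is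
immediate that `Φ'_{A_n}(0) → Φ'_A(0)`, by Cauchy's derivative formula (the maps may be extended
to a neighborhood of `0` by Schwarz reflection in the real line)" — GIVEN the convergence of the
maps. The tree's named fact `Literature.Probability.RandomPlanarGeometry.HasRestrictionDeriv.tendsto_of_kernel` (`HullExhaustion`) asks
for this under a Carathéodory-kernel hypothesis on increasing `*`-hulls `A_n ↑`, `A_n ⊆ A`,
`int ⋂ₙ (ℍ ∖ A_n) = ℍ ∖ A`. This file DISCHARGES it:

* `Literature.HasRestrictionDeriv.tendsto_of_kernel_holds : HasRestrictionDeriv.tendsto_of_kernel`.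

## Proof (the kernel theorem for this setting, by normal families)

1. `d ≤ d_{n+1} ≤ d_n ≤ 1` (monotonicity of `Φ'_·(0)` in the hull, `HullSubordination`), so
   `d_n ↓ d* ≥ d > 0`; it remains to show `d* ≤ d`.
2. Schwarz reflection near `0` (`RestrictionHullsProofs`): with `B(0, 2r) ∩ A = ∅` every `Φ_n`
   extends to a holomorphic `G_n` on `B(0, r)` with `|G_n| ≤ 2r`, `G_n(0) = 0`, `G_n'(0) = d_n`
   (`Literature.Probability.RandomPlanarGeometry.reflectExt`). Montel (`Literature.Analysis.Complex.Montel`): `G_{n_k} → G*` with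
   `G*'(0) = d*`.
3. Montel for `Φ_{n_k} : U = ℍ ∖ A → ℍ` through the Cayley transform
   (`exists_subseq_tendstoLocallyUniformlyOn_of_mapsTo`; non-degenerate since `im G*(it) > 0` for
   small `t`, as `G*'(0) = d* > 0`): `Φ_{n_k} → Φ*` locally uniformly, `Φ* = G*` on the upper
   half-disc, `Φ*` injective (Hurwitz, `Literature.Analysis.Complex.RiemannMapping`).
4. The inverses `Φ_{n_k}⁻¹ : ℍ → ℍ` likewise converge to `Ψ*` with `Ψ* ∘ Φ* = id_U`,
   `im Ψ* ≥ im` ([LSW] `Im Φ ≤ Im`), `Ψ*` injective; by Hurwitz's theorem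
   (`Literature.Analysis.Complex.Hurwitz`) `Ψ*(ℍ)` misses every `A_m` (a value `Ψ*(w) ∈ A_m`
   would be omitted by all `Φ_{n_k}⁻¹`, `n_k ≥ m`), and being open it lies in
   `int ⋂ (ℍ ∖ A_m) = U` — THE KERNEL HYPOTHESIS. So `Φ* : U → ℍ` is a conformal equivalence.
5. `T = Φ* ∘ Φ_A⁻¹ ∈ Aut(ℍ)` has boundary value `0` at `0`; in the normal form
   `q C⁻¹(u C z) + p` (`HalfPlaneAutomorphism`), `u ≠ 1` would give a finite limit at `∞`, while
   `T⁻¹(is) = Φ_A(Ψ*(is)) → ∞` (`im Ψ*(is) ≥ s`); hence `Φ* = q Φ_A`, `q d = d*` (derivatives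
   of the reflected extensions at `0`), and `q ≤ 1` from `im Φ* ≤ im` and `Φ_A(iy) ∼ iy`.

## References

* [LSW] proof of Lemma 3.5 (p. 12) [LawlerSchrammWerner2003Restriction].
* Ch. Pommerenke, *Boundary Behaviour of Conformal Maps* (1992), Thm. 1.8 (Carathéodory kernel
  theorem) [PommerenkeBBCM1992].
* J. B. Conway, *Functions of One Complex Variable I* (1978), VII.2.5 (Hurwitz), VII.2.9
  (Montel) [Conway1978].
-/

noncomputable section

open Set Filter Topology Metric Bornology Function Complex
open UpperHalfPlane (upperHalfPlaneSet isOpen_upperHalfPlaneSet)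
open scoped ComplexConjugate

namespace Literature.Probability.RandomPlanarGeometry

/-! ### Schwarz reflection of a restriction map near `0`, with uniform bounds -/

section NearZero

variable {A : Set ℂ} {Φ : ConformalEquiv (upperHalfPlaneSet \ A) upperHalfPlaneSet} {r : ℝ}

/-- **The reflected extension `G` of a restriction map near `0`**: on `B(0, r)` (where
`B(0, 2r) ∩ A = ∅`), `G = Φ` on the upper half-disc, `G(z̄) = conj G(z)` below, continuous
(Lipschitz) boundary values on `(-r, r)` in between (`RestrictionHullsProofs`). [folklore] -/
def reflectExt (hA : IsStarHull A) (hΦ : IsRestrictionMap A Φ) (hr : Disjoint (ball (0 : ℂ) (2 * r)) A) :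
    ℂ → ℂ :=
  fun z ↦ if 0 ≤ z.im then Classical.choose (hΦ.exists_extension hA hr) z
    else conj (Classical.choose (hΦ.exists_extension hA hr) (conj z))

variable (hA : IsStarHull A) (hΦ : IsRestrictionMap A Φ) (hr : Disjoint (ball (0 : ℂ) (2 * r)) A)
include hA hΦ hr

/-- `G = Φ` on the upper half-disc. [folklore] -/
theorem reflectExt_eq {z : ℂ} (hz : z ∈ upperHalfPlaneSet ∩ ball (0 : ℂ) r) : reflectExt hA hΦ hr z = Φ z := by
  have hG := Classical.choose_spec (hΦ.exists_extension hA hr)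
  simp only [reflectExt, if_pos (le_of_lt (show 0 < z.im from hz.1))]
  exact (hG.2 hz).symm

/-- `G` is holomorphic on `B(0, r)` (Schwarz reflection via Morera). [folklore] -/
theorem differentiableOn_reflectExt : DifferentiableOn ℂ (reflectExt hA hΦ hr) (ball (0 : ℂ) r) := by
  have hG := Classical.choose_spec (hΦ.exists_extension hA hr)
  refine SchwarzReflection.differentiableOn_reflect hG.1 ?_ fun t ht ↦ hΦ.extension_ofReal_im hA hr hG.1 hG.2 ht
  exact (Φ.differentiableOn_coe.mono (inter_ball_subset_diff hr)).congr fun z hz ↦ (hG.2 hz).symm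

/-- `G(0) = 0`. [folklore] -/
theorem reflectExt_zero (hr0 : 0 < r) : reflectExt hA hΦ hr 0 = 0 := by
  have hG := Classical.choose_spec (hΦ.exists_extension hA hr)
  simp only [reflectExt, zero_im, le_refl, if_true]
  exact hΦ.extension_zero hr hr0 hG.1 hG.2

/-- **`|Φ(z)| ≤ 2|z|` on the upper half-disc** (`Φ` is `2`-Lipschitz there with boundary value
`0` at `0`). [folklore] -/
theorem norm_le_two_mul_norm {z : ℂ} (hz : z ∈ upperHalfPlaneSet ∩ ball (0 : ℂ) r) : ‖Φ z‖ ≤ 2 * ‖z‖ := by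
  have hG := Classical.choose_spec (hΦ.exists_extension hA hr)
  have hL := hΦ.lipschitzOnWith hA hr
  set W := upperHalfPlaneSet ∩ ball (0 : ℂ) r
  have hr0 : 0 < r := by
    have := hz.2; rw [mem_ball_zero_iff] at this; exact (norm_nonneg _).trans_lt this
  have hmem : (0 : ℂ) ∈ closure W := by
    simpa using ofReal_mem_closure_inter_ball (r := r) (t := 0) (by simpa using hr0)
  haveI : (𝓝[W] (0 : ℂ)).NeBot := mem_closure_iff_nhdsWithin_neBot.1 hmem
  have h0 : Tendsto Φ (𝓝[W] 0) (𝓝 0) := by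
    have := tendsto_of_eqOn_extension hG.1 hG.2 (0 : ℂ)
    rwa [hΦ.extension_zero hr hr0 hG.1 hG.2] at this
  have h1 : Tendsto (fun w ↦ ‖Φ z - Φ w‖) (𝓝[W] 0) (𝓝 ‖Φ z - 0‖) :=
    (continuous_norm.tendsto _).comp (tendsto_const_nhds.sub h0)
  have h2 : Tendsto (fun w : ℂ ↦ 2 * ‖z - w‖) (𝓝[W] 0) (𝓝 (2 * ‖z - 0‖)) :=
    (((continuous_norm.comp (continuous_const.sub continuous_id)).tendsto 0).const_mul 2).mono_left
      nhdsWithin_le_nhds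
  rw [sub_zero] at h1 h2
  refine le_of_tendsto_of_tendsto h1 h2 (eventually_nhdsWithin_of_forall fun w hw ↦ ?_)
  have := hL.dist_le_mul z hz w hw
  rwa [dist_eq_norm, dist_eq_norm, NNReal.coe_ofNat] at this

/-- **`|G(z)| ≤ 2|z|` on `B(0, r)`.** [folklore] -/
theorem norm_reflectExt_le {z : ℂ} (hz : z ∈ ball (0 : ℂ) r) : ‖reflectExt hA hΦ hr z‖ ≤ 2 * ‖z‖ := by
  have hG := Classical.choose_spec (hΦ.exists_extension hA hr)
  set W := upperHalfPlaneSet ∩ ball (0 : ℂ) r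
  -- the bound for `G` on the closed upper half-disc (limit from `W`)
  have key : ∀ w ∈ ball (0 : ℂ) r, 0 ≤ w.im → ‖Classical.choose (hΦ.exists_extension hA hr) w‖ ≤ 2 * ‖w‖ := by
    intro w hw hwim
    have hmem : w ∈ closure W := by
      rcases hwim.lt_or_eq with hlt | heq
      · exact subset_closure ⟨hlt, hw⟩
      · have hwre : ((w.re : ℝ) : ℂ) = w := Complex.ext (by simp) (by simp [heq])
        rw [← hwre]
        refine ofReal_mem_closure_inter_ball ?_
        have := abs_re_le_norm w
        rw [mem_ball_zero_iff] at hw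
        exact this.trans_lt hw
    haveI : (𝓝[W] w).NeBot := mem_closure_iff_nhdsWithin_neBot.1 hmem
    have h1 : Tendsto (fun v ↦ ‖Φ v‖) (𝓝[W] w) (𝓝 ‖Classical.choose (hΦ.exists_extension hA hr) w‖) :=
      (continuous_norm.tendsto _).comp (tendsto_of_eqOn_extension hG.1 hG.2 w)
    have h2 : Tendsto (fun v : ℂ ↦ 2 * ‖v‖) (𝓝[W] w) (𝓝 (2 * ‖w‖)) :=
      ((continuous_norm.tendsto w).const_mul 2).mono_left nhdsWithin_le_nhds
    exact le_of_tendsto_of_tendsto h1 h2 (eventually_nhdsWithin_of_forall fun v hv ↦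
      norm_le_two_mul_norm hA hΦ hr hv)
  by_cases hzim : 0 ≤ z.im
  · simp only [reflectExt, if_pos hzim]; exact key z hz hzim
  · simp only [reflectExt, if_neg hzim, norm_conj]
    have hcz : conj z ∈ ball (0 : ℂ) r := by rwa [mem_ball_zero_iff, norm_conj, ← mem_ball_zero_iff]
    have := key (conj z) hcz (by rw [conj_im]; linarith [not_le.1 hzim])
    rwa [norm_conj] at this

/-- **`G'(0) = Φ'_A(0)`**: the derivative of the reflected extension at `0` is the number `d` of
`HasRestrictionDeriv`. [folklore] -/
theorem deriv_reflectExt_zero (hr0 : 0 < r) {d : ℝ} (hd : HasRestrictionDeriv A Φ d) :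
    deriv (reflectExt hA hΦ hr) 0 = d := by
  set G := reflectExt hA hΦ hr
  have hGd : DifferentiableAt ℂ G 0 :=
    (differentiableOn_reflectExt hA hΦ hr).differentiableAt (ball_mem_nhds 0 hr0)
  have hG0 : G 0 = 0 := reflectExt_zero hA hΦ hr hr0
  have h1 : Tendsto (fun z ↦ G z / z) (𝓝[≠] 0) (𝓝 (deriv G 0)) := by
    have := hGd.hasDerivAt.tendsto_slope_zero
    refine this.congr' (eventually_nhdsWithin_of_forall fun z _ ↦ ?_)
    simp only [zero_add, hG0, sub_zero, smul_eq_mul, div_eq_inv_mul]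
  set W := upperHalfPlaneSet ∩ ball (0 : ℂ) r
  have hmem : (0 : ℂ) ∈ closure W := by
    simpa using ofReal_mem_closure_inter_ball (r := r) (t := 0) (by simpa using hr0)
  haveI : (𝓝[W] (0 : ℂ)).NeBot := mem_closure_iff_nhdsWithin_neBot.1 hmem
  have hW0 : W ⊆ {(0 : ℂ)}ᶜ := fun z hz h0 ↦ by
    have : (0 : ℝ) < z.im := hz.1
    rw [h0, zero_im] at this; exact lt_irrefl _ this
  have h2 : Tendsto (fun z ↦ G z / z) (𝓝[W] 0) (𝓝 (deriv G 0)) := h1.mono_left (nhdsWithin_mono _ hW0)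
  have h3 : Tendsto (fun z ↦ G z / z) (𝓝[W] 0) (𝓝 (d : ℂ)) := by
    have := (hd : Tendsto (fun z ↦ Φ z / z) (𝓝[upperHalfPlaneSet \ A] 0) (𝓝 (d : ℂ))).mono_left
      (nhdsWithin_mono _ (inter_ball_subset_diff hr))
    exact this.congr' (eventually_nhdsWithin_of_forall fun z hz ↦ by
      show Φ z / z = G z / z; rw [show G z = Φ z from reflectExt_eq hA hΦ hr hz])
  exact tendsto_nhds_unique h2 h3

end NearZero

/-! ### Montel for maps into the half-plane -/

/-- **Normal families of maps into `ℍ`**: holomorphic `F n : U → ℍ` on an open preconnected `U`,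
non-degenerate along some convergent sequence of points (`F n (z n) → w₀ ∈ ℍ`, `z n → z₁ ∈ U`),
have a subsequence converging locally uniformly on `U` to a holomorphic `f : U → ℍ` (Montel for
the Cayley transforms `C ∘ F n : U → 𝔻`; the limit misses `∂𝔻` by the maximum principle).
[folklore] -/
theorem exists_subseq_tendstoLocallyUniformlyOn_of_mapsTo {U : Set ℂ} (hU : IsOpen U)
    (hUc : IsPreconnected U) {F : ℕ → ℂ → ℂ} (hF : ∀ n, DifferentiableOn ℂ (F n) U)
    (hmaps : ∀ n, MapsTo (F n) U upperHalfPlaneSet) {z : ℕ → ℂ} (hz : ∀ n, z n ∈ U) {z₁ : ℂ}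
    (hz₁ : z₁ ∈ U) (hzlim : Tendsto z atTop (𝓝 z₁)) {w₀ : ℂ} (hw₀ : w₀ ∈ upperHalfPlaneSet)
    (hFz : Tendsto (fun n ↦ F n (z n)) atTop (𝓝 w₀)) :
    ∃ (φ : ℕ → ℕ) (f : ℂ → ℂ), StrictMono φ ∧ DifferentiableOn ℂ f U ∧ MapsTo f U upperHalfPlaneSet ∧
      TendstoLocallyUniformlyOn (fun n ↦ F (φ n)) f atTop U := by
  -- Montel for the Cayley transforms
  set C : ℕ → ℂ → ℂ := fun n w ↦ cayleyFun (F n w) with hC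
  have hCd : ∀ n, DifferentiableOn ℂ (C n) U := fun n ↦
    differentiableOn_cayleyFun.comp (hF n) fun w hw ↦ add_I_ne_zero (le_of_lt (hmaps n hw))
  have hC1 : ∀ n, ∀ w ∈ U, ‖C n w‖ ≤ 1 := fun n w hw ↦
    ((norm_cayleyFun_lt_one_iff (add_I_ne_zero (le_of_lt (hmaps n hw)))).2 (hmaps n hw)).le
  obtain ⟨h, φ, hφ, hhd, hlim, -⟩ := Complex.exists_strictMono_tendstoLocallyUniformlyOn_of_norm_le hU hCd hC1
  -- the limit at `z₁` is `C w₀ ∈ 𝔻`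
  have hz₁lim : Tendsto (fun n ↦ C (φ n) (z (φ n))) atTop (𝓝 (h z₁)) := by
    refine hlim.tendsto_comp (hhd.continuousOn.continuousWithinAt hz₁) hz₁ ?_
    exact tendsto_nhdsWithin_iff.2 ⟨hzlim.comp hφ.tendsto_atTop, Eventually.of_forall fun n ↦ hz _⟩
  have hz₁lim' : Tendsto (fun n ↦ C (φ n) (z (φ n))) atTop (𝓝 (cayleyFun w₀)) := by
    have hc : ContinuousAt cayleyFun w₀ :=
      continuousOn_cayleyFun.continuousAt (isOpen_ne_fun (by fun_prop) (by fun_prop) |>.mem_nhds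
        (add_I_ne_zero (le_of_lt hw₀)))
    exact hc.tendsto.comp (hFz.comp hφ.tendsto_atTop)
  have hhz₁ : h z₁ = cayleyFun w₀ := tendsto_nhds_unique hz₁lim hz₁lim'
  have hhz₁lt : ‖h z₁‖ < 1 := by
    rw [hhz₁]; exact (norm_cayleyFun_lt_one_iff (add_I_ne_zero (le_of_lt hw₀))).2 hw₀
  -- `‖h‖ < 1` on `U` (maximum principle)
  have hle : ∀ w ∈ U, ‖h w‖ ≤ 1 := fun w hw ↦
    le_of_tendsto ((continuous_norm.tendsto _).comp (hlim.tendsto_at hw)) (Eventually.of_forall fun n ↦ hC1 _ w hw)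
  have hlt : ∀ w ∈ U, ‖h w‖ < 1 := by
    intro w hw
    refine lt_of_le_of_ne (hle w hw) fun heq ↦ ?_
    have hmax : IsMaxOn (norm ∘ h) U w := fun v hv ↦ by
      simp only [Function.comp_apply, mem_setOf_eq, heq]; exact hle v hv
    have := Complex.eqOn_of_isPreconnected_of_isMaxOn_norm hUc hU hhd hw hmax hz₁
    have h1 : h z₁ = h w := this
    rw [h1, heq] at hhz₁lt
    exact lt_irrefl _ hhz₁lt
  -- back through `C⁻¹`
  refine ⟨φ, fun w ↦ cayleyInvFun (h w), hφ, ?_, fun w hw ↦ ?_, ?_⟩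
  · exact differentiableOn_cayleyInvFun.comp hhd fun w hw h1 ↦ by
      have := hlt w hw; rw [h1, norm_one] at this; exact lt_irrefl _ this
  · exact cayley.symm_mapsTo (mem_ball_zero_iff.2 (hlt w hw))
  · rw [tendstoLocallyUniformlyOn_iff_forall_isCompact hU]
    intro K hKU hK
    -- `h(K) ⊆ closedBall 0 ρ`, `ρ < 1`
    obtain ⟨ρ, hρ1, hρ⟩ : ∃ ρ < 1, ∀ w ∈ K, ‖h w‖ ≤ ρ := by
      rcases K.eq_empty_or_nonempty with rfl | hKne
      · exact ⟨0, one_pos, by simp⟩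
      obtain ⟨w₁, hw₁, hmax⟩ := hK.exists_isMaxOn hKne ((continuous_norm.comp_continuousOn
        (hhd.continuousOn.mono hKU)))
      exact ⟨‖h w₁‖, hlt w₁ (hKU hw₁), fun w hw ↦ hmax hw⟩
    set s : Set ℂ := closedBall (0 : ℂ) ((1 + ρ) / 2) with hs
    have hs1 : s ⊆ {w | w ≠ 1} := fun w hw h1 ↦ by
      rw [hs, mem_closedBall_zero_iff, h1, norm_one] at hw; linarith
    have hsu : UniformContinuousOn cayleyInvFun s :=
      (isCompact_closedBall _ _).uniformContinuousOn_of_continuous (differentiableOn_cayleyInvFun.continuousOn.mono hs1)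
    have hunif : TendstoUniformlyOn (fun n ↦ C (φ n)) h atTop K :=
      (tendstoLocallyUniformlyOn_iff_forall_isCompact hU).1 hlim K hKU hK
    have hFev : ∀ᶠ n in atTop, ∀ w ∈ K, C (φ n) w ∈ s := by
      have h1 : 0 < (1 - ρ) / 2 := by linarith
      filter_upwards [(Metric.tendstoUniformlyOn_iff.1 hunif) _ h1] with n hn w hw
      rw [hs, mem_closedBall_zero_iff]
      have := hn w hw
      rw [dist_eq_norm] at this
      calc ‖C (φ n) w‖ = ‖h w - (h w - C (φ n) w)‖ := by ring_nf
        _ ≤ ‖h w‖ + ‖h w - C (φ n) w‖ := norm_sub_le _ _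
        _ ≤ (1 + ρ) / 2 := by linarith [hρ w hw]
    have hfs : ∀ w ∈ K, h w ∈ s := fun w hw ↦ by
      rw [hs, mem_closedBall_zero_iff]; linarith [hρ w hw]
    have key := hsu.comp_tendstoUniformlyOn_eventually hFev hfs hunif
    refine key.congr (Eventually.of_forall fun n w hw ↦ ?_)
    simp only [hC]
    exact cayleyInvFun_cayleyFun (add_I_ne_zero (le_of_lt (hmaps _ (hKU hw))))

/-! ### The monotone limit `d_n ↓ d* ≥ d` -/

section Monotone

variable {A : Set ℂ} {An : ℕ → Set ℂ} {Φ : ConformalEquiv (upperHalfPlaneSet \ A) upperHalfPlaneSet}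
  {Φn : ∀ n, ConformalEquiv (upperHalfPlaneSet \ An n) upperHalfPlaneSet} {d : ℝ} {dn : ℕ → ℝ}

/-- **`d ≤ d_{n+1} ≤ d_n ≤ 1`, so `d_n → d* ∈ [d, 1]`** (monotonicity of `Φ'_A(0)` in the hull,
`HullSubordination`). [cite: LawlerSchrammWerner2003Restriction, §2 p. 8 with (2.4) p. 7] -/
theorem exists_tendsto_restrictionDeriv_of_monotone (hA : IsStarHull A) (hAn : ∀ n, IsStarHull (An n))
    (hmono : Monotone An) (hsub : ∀ n, An n ⊆ A) (hΦ : IsRestrictionMap A Φ) (hd : HasRestrictionDeriv A Φ d)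
    (hΦn : ∀ n, IsRestrictionMap (An n) (Φn n)) (hdn : ∀ n, HasRestrictionDeriv (An n) (Φn n) (dn n)) :
    ∃ dstar : ℝ, Tendsto dn atTop (𝓝 dstar) ∧ d ≤ dstar ∧ dstar ≤ 1 ∧ 0 < d ∧ Antitone dn ∧ ∀ n, d ≤ dn n := by
  have hle : ∀ n, d ≤ dn n := fun n ↦ hd.le_of_subset hA (hAn n) (hsub n) hΦ (hΦn n) (hdn n)
  have hanti : Antitone dn := antitone_nat_of_succ_le fun n ↦
    (hdn (n + 1)).le_of_subset (hAn (n + 1)) (hAn n) (hmono n.le_succ) (hΦn (n + 1)) (hΦn n) (hdn n)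
  obtain ⟨d', hd'0, hd'1, hd'⟩ := IsStarHull.exists_hasRestrictionDeriv_holds hA hΦ
  have hdd' : d = d' := hd.unique hA hd'
  subst hdd'
  have hdn1 : ∀ n, dn n ≤ 1 := fun n ↦ by
    obtain ⟨e, -, he1, he⟩ := IsStarHull.exists_hasRestrictionDeriv_holds (hAn n) (hΦn n)
    rwa [(hdn n).unique (hAn n) he]
  have hbdd : BddBelow (range dn) := ⟨d, by rintro _ ⟨n, rfl⟩; exact hle n⟩
  refine ⟨⨅ n, dn n, tendsto_atTop_ciInf hanti hbdd, le_ciInf hle, (ciInf_le hbdd 0).trans (hdn1 0), hd'0,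
    hanti, hle⟩

end Monotone

/-! ### The kernel argument -/

section Kernel

variable {A : Set ℂ} {An : ℕ → Set ℂ} {Φ : ConformalEquiv (upperHalfPlaneSet \ A) upperHalfPlaneSet}
  {Φn : ∀ n, ConformalEquiv (upperHalfPlaneSet \ An n) upperHalfPlaneSet} {d : ℝ} {dn : ℕ → ℝ}

/-- A `*`-hull misses a ball `B(0, 2r)`. [folklore] -/
theorem IsStarHull.exists_disjoint_ball (hA : IsStarHull A) : ∃ r > 0, Disjoint (ball (0 : ℂ) (2 * r)) A := by
  obtain ⟨ε, hε, hball⟩ := Metric.isOpen_iff.1 hA.1.isClosed.isOpen_compl 0 hA.2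
  refine ⟨ε / 2, by positivity, Set.disjoint_left.2 fun z hz hzA ↦ hball ?_ hzA⟩
  rwa [show 2 * (ε / 2) = ε by ring] at hz

/-- For `z = it`, `im w = t · re (w / z)`. [folklore] -/
theorem im_eq_mul_re_div_I_mul (w : ℂ) {t : ℝ} (ht : t ≠ 0) : w.im = t * (w / (I * t)).re := by
  have hz : (I * t : ℂ) ≠ 0 := mul_ne_zero I_ne_zero (ofReal_ne_zero.2 ht)
  have : w = (w / (I * t)) * (I * t) := by rw [div_mul_cancel₀ _ hz]
  conv_lhs => rw [this]
  simp [mul_im]; ring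

/-- **Extraction.** Along a subsequence, the reflected extensions `G_n` converge locally
uniformly on `B(0, r)` to a holomorphic `G*` with `G*(0) = 0`, `G*'(0) = d* = lim d_n`, and the
maps `Φ_n` converge locally uniformly on `U = ℍ ∖ A` to a holomorphic `Φ* : U → ℍ` agreeing with
`G*` on the upper half-disc (Montel twice; non-degeneracy from `G*'(0) = d* > 0`). [folklore] -/
theorem kernel_extraction (hA : IsStarHull A) (hAn : ∀ n, IsStarHull (An n)) (hsub : ∀ n, An n ⊆ A)
    (hΦn : ∀ n, IsRestrictionMap (An n) (Φn n)) (hdn : ∀ n, HasRestrictionDeriv (An n) (Φn n) (dn n))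
    {dstar : ℝ} (hdlim : Tendsto dn atTop (𝓝 dstar)) (hdpos : 0 < dstar)
    {r : ℝ} (hr0 : 0 < r) (hr : Disjoint (ball (0 : ℂ) (2 * r)) A) :
    ∃ (φ : ℕ → ℕ) (Φs Gs : ℂ → ℂ), StrictMono φ ∧
      DifferentiableOn ℂ Gs (ball 0 r) ∧ Gs 0 = 0 ∧ deriv Gs 0 = dstar ∧
      DifferentiableOn ℂ Φs (upperHalfPlaneSet \ A) ∧ MapsTo Φs (upperHalfPlaneSet \ A) upperHalfPlaneSet ∧
      TendstoLocallyUniformlyOn (fun k ↦ (Φn (φ k) : ℂ → ℂ)) Φs atTop (upperHalfPlaneSet \ A) ∧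
      EqOn Φs Gs (upperHalfPlaneSet ∩ ball 0 r) := by
  set U := upperHalfPlaneSet \ A with hU
  have hUo : IsOpen U := hA.1.isOpen_diff
  have hUc : IsPreconnected U := hA.1.isPreconnected_diff
  have hrn : ∀ n, Disjoint (ball (0 : ℂ) (2 * r)) (An n) := fun n ↦ hr.mono_right (hsub n)
  -- Montel for the reflected extensions
  set G : ℕ → ℂ → ℂ := fun n ↦ reflectExt (hAn n) (hΦn n) (hrn n) with hG
  have hGd : ∀ n, DifferentiableOn ℂ (G n) (ball 0 r) := fun n ↦ differentiableOn_reflectExt (hAn n) (hΦn n) (hrn n)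
  have hGb : ∀ n, ∀ z ∈ ball (0 : ℂ) r, ‖G n z‖ ≤ 2 * r := fun n z hz ↦
    (norm_reflectExt_le (hAn n) (hΦn n) (hrn n) hz).trans (by rw [mem_ball_zero_iff] at hz; linarith)
  obtain ⟨Gs, φ₁, hφ₁, hGsd, hGlim, hGdlim⟩ :=
    Complex.exists_strictMono_tendstoLocallyUniformlyOn_of_norm_le isOpen_ball hGd hGb
  have h0mem : (0 : ℂ) ∈ ball (0 : ℂ) r := mem_ball_self hr0
  have hGs0 : Gs 0 = 0 := by
    have h1 := hGlim.tendsto_at h0mem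
    have h2 : Tendsto (fun k ↦ G (φ₁ k) 0) atTop (𝓝 0) :=
      tendsto_const_nhds.congr fun k ↦ (reflectExt_zero (hAn _) (hΦn _) (hrn _) hr0).symm
    exact tendsto_nhds_unique h1 h2
  have hGs' : deriv Gs 0 = dstar := by
    have h1 := hGdlim.tendsto_at h0mem
    have h2 : Tendsto (fun k ↦ deriv (G (φ₁ k)) 0) atTop (𝓝 (dstar : ℂ)) := by
      have := ((continuous_ofReal.tendsto dstar).comp (hdlim.comp hφ₁.tendsto_atTop))
      exact this.congr fun k ↦ (deriv_reflectExt_zero (hAn _) (hΦn _) (hrn _) hr0 (hdn _)).symm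
    exact tendsto_nhds_unique h1 h2
  -- a point `z₀ = i t₀` of the upper half-disc with `im G*(z₀) > 0`
  obtain ⟨t₀, ht₀, ht₀r, hpos⟩ : ∃ t₀ : ℝ, 0 < t₀ ∧ t₀ < r ∧ 0 < (Gs (I * t₀)).im := by
    have hGsd0 : HasDerivAt Gs (deriv Gs 0) 0 := (hGsd.differentiableAt (ball_mem_nhds 0 hr0)).hasDerivAt
    have h1 : Tendsto (fun z ↦ Gs z / z) (𝓝[≠] 0) (𝓝 (deriv Gs 0)) := by
      refine hGsd0.tendsto_slope_zero.congr' (eventually_nhdsWithin_of_forall fun z _ ↦ ?_)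
      simp only [zero_add, hGs0, sub_zero, smul_eq_mul, div_eq_inv_mul]
    have h2 : Tendsto (fun t : ℝ ↦ (I * t : ℂ)) (𝓝[>] 0) (𝓝[≠] 0) := by
      refine tendsto_nhdsWithin_iff.2 ⟨?_, ?_⟩
      · have : Continuous fun t : ℝ ↦ (I * t : ℂ) := by fun_prop
        simpa using (this.tendsto 0).mono_left nhdsWithin_le_nhds
      · filter_upwards [self_mem_nhdsWithin] with t ht
        exact mul_ne_zero I_ne_zero (ofReal_ne_zero.2 (ne_of_gt ht))
    have h3 := ((continuous_re.tendsto _).comp (h1.comp h2))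
    rw [hGs', ofReal_re] at h3
    have hev := (tendsto_order.1 h3).1 (dstar / 2) (by linarith)
    have hev' : ∀ᶠ t : ℝ in 𝓝[>] 0, t < r := nhdsWithin_le_nhds (Iio_mem_nhds hr0)
    obtain ⟨t₀, ⟨hlt, hltr⟩, ht₀⟩ := ((hev.and hev').and self_mem_nhdsWithin).exists
    have ht₀ : 0 < t₀ := ht₀
    refine ⟨t₀, ht₀, hltr, ?_⟩
    rw [im_eq_mul_re_div_I_mul (Gs (I * t₀)) ht₀.ne']
    have : dstar / 2 < (Gs (I * ↑t₀) / (I * ↑t₀)).re := hlt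
    exact mul_pos ht₀ (by linarith)
  set z₀ : ℂ := I * t₀ with hz₀
  have hz₀ball : z₀ ∈ ball (0 : ℂ) r := by
    rw [mem_ball_zero_iff, hz₀, norm_mul, norm_I, one_mul, norm_real, Real.norm_of_nonneg ht₀.le]; exact ht₀r
  have hz₀H : z₀ ∈ upperHalfPlaneSet := by show 0 < z₀.im; simp [hz₀, ht₀]
  have hz₀U : z₀ ∈ U := inter_ball_subset_diff hr ⟨hz₀H, hz₀ball⟩
  -- Montel into the half-plane for `Φ_{φ₁ k}` on `U`
  have hF : ∀ k, DifferentiableOn ℂ (Φn (φ₁ k) : ℂ → ℂ) U := fun k ↦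
    (Φn (φ₁ k)).differentiableOn_coe.mono fun z hz ↦ ⟨hz.1, fun h ↦ hz.2 (hsub _ h)⟩
  have hmaps : ∀ k, MapsTo (Φn (φ₁ k) : ℂ → ℂ) U upperHalfPlaneSet := fun k z hz ↦
    (Φn (φ₁ k)).mapsTo ⟨hz.1, fun h ↦ hz.2 (hsub _ h)⟩
  have hFz : Tendsto (fun k ↦ Φn (φ₁ k) z₀) atTop (𝓝 (Gs z₀)) := by
    refine (hGlim.tendsto_at hz₀ball).congr fun k ↦ ?_
    exact reflectExt_eq (hAn _) (hΦn _) (hrn _) ⟨hz₀H, hz₀ball⟩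
  obtain ⟨φ₂, Φs, hφ₂, hΦsd, hΦsm, hΦslim⟩ := exists_subseq_tendstoLocallyUniformlyOn_of_mapsTo hUo hUc hF hmaps
    (fun _ ↦ hz₀U) hz₀U tendsto_const_nhds hpos hFz
  refine ⟨φ₁ ∘ φ₂, Φs, Gs, hφ₁.comp hφ₂, hGsd, hGs0, hGs', hΦsd, hΦsm, hΦslim, fun z hz ↦ ?_⟩
  have hzU : z ∈ U := inter_ball_subset_diff hr hz
  have h1 : Tendsto (fun k ↦ Φn (φ₁ (φ₂ k)) z) atTop (𝓝 (Φs z)) := hΦslim.tendsto_at hzU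
  have h2 : Tendsto (fun k ↦ Φn (φ₁ (φ₂ k)) z) atTop (𝓝 (Gs z)) := by
    refine ((hGlim.tendsto_at hz.2).comp hφ₂.tendsto_atTop).congr fun k ↦ ?_
    exact reflectExt_eq (hAn _) (hΦn _) (hrn _) hz
  exact tendsto_nhds_unique h1 h2

/-- Subtracting a constant preserves locally uniform convergence. [folklore] -/
theorem tendstoLocallyUniformlyOn_sub_const {s : Set ℂ} {F : ℕ → ℂ → ℂ} {f : ℂ → ℂ}
    (h : TendstoLocallyUniformlyOn F f atTop s) (c : ℂ) :
    TendstoLocallyUniformlyOn (fun n z ↦ F n z - c) (fun z ↦ f z - c) atTop s := by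
  rw [Metric.tendstoLocallyUniformlyOn_iff] at h ⊢
  intro ε hε x hx
  obtain ⟨t, ht, hev⟩ := h ε hε x hx
  refine ⟨t, ht, hev.mono fun n hn y hy ↦ ?_⟩
  rw [dist_sub_right]; exact hn y hy

/-- **The limit `Φ*` is injective and non-constant** (Hurwitz; `G*'(0) = d* ≠ 0`). [folklore] -/
theorem kernel_injOn (hA : IsStarHull A) (hsub : ∀ n, An n ⊆ A) {φ : ℕ → ℕ} {Φs Gs : ℂ → ℂ}
    {r : ℝ} (hr0 : 0 < r) (hr : Disjoint (ball (0 : ℂ) (2 * r)) A) (hGsd : DifferentiableOn ℂ Gs (ball 0 r))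
    {dstar : ℝ} (hGs' : deriv Gs 0 = dstar) (hdpos : 0 < dstar)
    (hΦslim : TendstoLocallyUniformlyOn (fun k ↦ (Φn (φ k) : ℂ → ℂ)) Φs atTop (upperHalfPlaneSet \ A))
    (hEq : EqOn Φs Gs (upperHalfPlaneSet ∩ ball 0 r)) :
    InjOn Φs (upperHalfPlaneSet \ A) ∧ ∀ c : ℂ, ¬ EqOn Φs (fun _ ↦ c) (upperHalfPlaneSet \ A) := by
  set U := upperHalfPlaneSet \ A
  have hUo : IsOpen U := hA.1.isOpen_diff
  have hUc : IsPreconnected U := hA.1.isPreconnected_diff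
  -- a point of the upper half-disc
  set z₁ : ℂ := I * ((r / 2 : ℝ) : ℂ) with hz₁
  have hz₁W : z₁ ∈ upperHalfPlaneSet ∩ ball (0 : ℂ) r := by
    refine ⟨show 0 < z₁.im by simp [hz₁, hr0], ?_⟩
    rw [mem_ball_zero_iff, hz₁, norm_mul, norm_I, one_mul, norm_real, Real.norm_of_nonneg (by positivity)]
    linarith
  have hWo : IsOpen (upperHalfPlaneSet ∩ ball (0 : ℂ) r) := isOpen_upperHalfPlaneSet.inter isOpen_ball
  have hnc : ∀ c : ℂ, ¬ EqOn Φs (fun _ ↦ c) U := by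
    intro c hc
    -- `Gs = c` near `z₁`, hence on the ball, hence `G*'(0) = 0`
    have hev : Gs =ᶠ[𝓝 z₁] fun _ ↦ c := by
      filter_upwards [hWo.mem_nhds hz₁W] with z hz
      rw [← hEq hz, hc (inter_ball_subset_diff hr hz)]
    have hball : EqOn Gs (fun _ ↦ c) (ball 0 r) :=
      (hGsd.analyticOnNhd isOpen_ball).eqOn_of_preconnected_of_eventuallyEq analyticOnNhd_const
        (convex_ball _ _).isPreconnected hz₁W.2 hev
    have hev0 : Gs =ᶠ[𝓝 0] fun _ ↦ c := by
      filter_upwards [isOpen_ball.mem_nhds (mem_ball_self hr0)] with z hz using hball hz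
    have := hev0.deriv_eq
    rw [deriv_const, hGs'] at this
    exact absurd (by exact_mod_cast this : dstar = 0) hdpos.ne'
  refine ⟨?_, hnc⟩
  have hF : ∀ᶠ k in atTop, DifferentiableOn ℂ (Φn (φ k) : ℂ → ℂ) U := Eventually.of_forall fun k ↦
    (Φn (φ k)).differentiableOn_coe.mono fun z hz ↦ ⟨hz.1, fun h ↦ hz.2 (hsub _ h)⟩
  have hinj : ∀ᶠ k in atTop, InjOn (Φn (φ k) : ℂ → ℂ) U := Eventually.of_forall fun k ↦
    (Φn (φ k)).injOn.mono (show U ⊆ upperHalfPlaneSet \ An (φ k) from fun z hz ↦ ⟨hz.1, fun h ↦ hz.2 (hsub _ h)⟩)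
  rcases Complex.exists_eqOn_const_or_injOn_of_tendstoLocallyUniformlyOn hUo hUc hF hinj hΦslim with ⟨c, hc⟩ | h
  · exact absurd hc (hnc c)
  · exact h

/-- **The inverse family and the kernel.** Along a further subsequence `Φ_{φ ψ k}⁻¹ → Ψ*`
locally uniformly on `ℍ`, with `Ψ* ∘ Φ* = id` on `U`, `Ψ*` injective, `im Ψ*(w) ≥ im w`, and —
by the KERNEL hypothesis and Hurwitz's theorem — `Ψ*(ℍ) ⊆ U = ℍ ∖ A`. [folklore] -/
theorem kernel_inverse (hA : IsStarHull A) (hAn : ∀ n, IsStarHull (An n)) (hmono : Monotone An)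
    (hsub : ∀ n, An n ⊆ A) (hker : interior (⋂ n, upperHalfPlaneSet \ An n) = upperHalfPlaneSet \ A)
    (hΦn : ∀ n, IsRestrictionMap (An n) (Φn n)) {φ : ℕ → ℕ} (hφ : StrictMono φ) {Φs : ℂ → ℂ}
    (hΦsm : MapsTo Φs (upperHalfPlaneSet \ A) upperHalfPlaneSet)
    (hΦslim : TendstoLocallyUniformlyOn (fun k ↦ (Φn (φ k) : ℂ → ℂ)) Φs atTop (upperHalfPlaneSet \ A))
    {z₀ : ℂ} (hz₀ : z₀ ∈ upperHalfPlaneSet \ A) :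
    ∃ Ψs : ℂ → ℂ, DifferentiableOn ℂ Ψs upperHalfPlaneSet ∧ MapsTo Ψs upperHalfPlaneSet (upperHalfPlaneSet \ A) ∧
      (∀ z ∈ upperHalfPlaneSet \ A, Ψs (Φs z) = z) ∧ InjOn Ψs upperHalfPlaneSet ∧
      ∀ w ∈ upperHalfPlaneSet, w.im ≤ (Ψs w).im := by
  set U := upperHalfPlaneSet \ A
  have hUo : IsOpen U := hA.1.isOpen_diff
  have hUn : ∀ k, U ⊆ upperHalfPlaneSet \ An (φ k) := fun k z hz ↦ ⟨hz.1, fun h ↦ hz.2 (hsub _ h)⟩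
  -- the inverse family
  set F : ℕ → ℂ → ℂ := fun k ↦ ((Φn (φ k)).symm : ℂ → ℂ) with hF
  have hFd : ∀ k, DifferentiableOn ℂ (F k) upperHalfPlaneSet := fun k ↦ (Φn (φ k)).symm.differentiableOn_coe
  have hFm : ∀ k, MapsTo (F k) upperHalfPlaneSet upperHalfPlaneSet := fun k w hw ↦ ((Φn (φ k)).symm_mapsTo hw).1
  have hzk : ∀ k, Φn (φ k) z₀ ∈ upperHalfPlaneSet := fun k ↦ (Φn (φ k)).mapsTo (hUn k hz₀)
  have hz₁ : Φs z₀ ∈ upperHalfPlaneSet := hΦsm hz₀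
  have hFz : Tendsto (fun k ↦ F k (Φn (φ k) z₀)) atTop (𝓝 z₀) :=
    tendsto_const_nhds.congr fun k ↦ ((Φn (φ k)).symm_apply_apply (hUn k hz₀)).symm
  obtain ⟨ψ, Ψs, hψ, hΨsd, hΨsm, hΨlim⟩ := exists_subseq_tendstoLocallyUniformlyOn_of_mapsTo
    isOpen_upperHalfPlaneSet (convex_halfSpace_im_gt 0).isPreconnected hFd hFm hzk hz₁
    (hΦslim.tendsto_at hz₀) hz₀.1 hFz
  -- `Ψ* ∘ Φ* = id` on `U`
  have hleft : ∀ z ∈ U, Ψs (Φs z) = z := by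
    intro z hz
    have hg : Tendsto (fun k ↦ Φn (φ (ψ k)) z) atTop (𝓝[upperHalfPlaneSet] (Φs z)) :=
      tendsto_nhdsWithin_iff.2 ⟨(hΦslim.tendsto_at hz).comp hψ.tendsto_atTop,
        Eventually.of_forall fun k ↦ (Φn _).mapsTo (hUn _ hz)⟩
    have h1 := hΨlim.tendsto_comp (hΨsd.continuousOn.continuousWithinAt (hΦsm hz)) (hΦsm hz) hg
    have h2 : Tendsto (fun k ↦ F (ψ k) (Φn (φ (ψ k)) z)) atTop (𝓝 z) :=
      tendsto_const_nhds.congr fun k ↦ ((Φn (φ (ψ k))).symm_apply_apply (hUn _ hz)).symm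
    exact tendsto_nhds_unique h1 h2
  -- `im Ψ* ≥ im`
  have him : ∀ w ∈ upperHalfPlaneSet, w.im ≤ (Ψs w).im := by
    intro w hw
    refine ge_of_tendsto ((continuous_im.tendsto _).comp (hΨlim.tendsto_at hw)) (Eventually.of_forall fun k ↦ ?_)
    have hmem := (Φn (φ (ψ k))).symm_mapsTo hw
    have := (hΦn (φ (ψ k))).im_le_im (hAn _).1.1 hmem
    rw [(Φn (φ (ψ k))).apply_symm_apply hw] at this
    exact this
  -- `Ψ*` is not constant, hence injective (Hurwitz)
  have hnc : ∀ c : ℂ, ¬ EqOn Ψs (fun _ ↦ c) upperHalfPlaneSet := by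
    intro c hc
    obtain ⟨ε, hε, hball⟩ := Metric.isOpen_iff.1 hUo z₀ hz₀
    have hz' : z₀ + (ε / 2 : ℝ) ∈ U := hball (by
      rw [mem_ball, dist_eq_norm, add_sub_cancel_left, norm_real, Real.norm_of_nonneg (by positivity)]; linarith)
    have h1 : Ψs (Φs z₀) = z₀ := hleft z₀ hz₀
    have h2 : Ψs (Φs (z₀ + (ε / 2 : ℝ))) = z₀ + (ε / 2 : ℝ) := hleft _ hz'
    rw [hc (hΦsm hz₀)] at h1
    rw [hc (hΦsm hz'), h1] at h2
    have : ((ε / 2 : ℝ) : ℂ) = 0 := by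
      have := congrArg (· - z₀) h2; simpa using this.symm
    rw [ofReal_eq_zero] at this
    linarith
  have hinj : InjOn Ψs upperHalfPlaneSet := by
    have hF' : ∀ᶠ k in atTop, DifferentiableOn ℂ (F (ψ k)) upperHalfPlaneSet := Eventually.of_forall fun k ↦ hFd _
    have hinj' : ∀ᶠ k in atTop, InjOn (F (ψ k)) upperHalfPlaneSet := Eventually.of_forall fun k ↦ (Φn _).symm.injOn
    rcases Complex.exists_eqOn_const_or_injOn_of_tendstoLocallyUniformlyOn isOpen_upperHalfPlaneSet
      (convex_halfSpace_im_gt 0).isPreconnected hF' hinj' hΨlim with ⟨c, hc⟩ | h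
    · exact absurd hc (hnc c)
    · exact h
  -- KERNEL: `Ψ*(ℍ)` misses every `A_m` (Hurwitz), is open, hence lies in `int ⋂ (ℍ ∖ A_m) = U`
  have hmiss : ∀ w ∈ upperHalfPlaneSet, ∀ m, Ψs w ∉ An m := by
    intro w hw m hζ
    set ζ := Ψs w
    have hlim' : TendstoLocallyUniformlyOn (fun k v ↦ F (ψ k) v - ζ) (fun v ↦ Ψs v - ζ) atTop upperHalfPlaneSet :=
      tendstoLocallyUniformlyOn_sub_const hΨlim ζ
    have hF' : ∀ᶠ k in atTop, DifferentiableOn ℂ (fun v ↦ F (ψ k) v - ζ) upperHalfPlaneSet :=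
      Eventually.of_forall fun k ↦ (hFd _).sub_const ζ
    have h0 : ∃ᶠ k in atTop, ∀ v ∈ upperHalfPlaneSet, F (ψ k) v - ζ ≠ 0 := by
      refine Eventually.frequently ?_
      have hev : ∀ᶠ k in atTop, m ≤ φ (ψ k) := (hφ.comp hψ).tendsto_atTop.eventually (eventually_ge_atTop m)
      filter_upwards [hev] with k hk v hv h0
      have hmem := (Φn (φ (ψ k))).symm_mapsTo hv
      rw [sub_eq_zero] at h0
      have := hmono hk hζ
      rw [← h0] at this
      exact hmem.2 this
    rcases hurwitz_eqOn_zero_or_forall_ne_zero isOpen_upperHalfPlaneSet (convex_halfSpace_im_gt 0).isPreconnected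
      hF' hlim' h0 with h | h
    · refine hnc ζ fun v hv ↦ ?_
      have := h hv; simpa [sub_eq_zero] using this
    · exact h w hw (sub_self _)
  have hopen : IsOpen (Ψs '' upperHalfPlaneSet) := by
    rcases (hΨsd.analyticOnNhd isOpen_upperHalfPlaneSet).is_constant_or_isOpen
      (convex_halfSpace_im_gt 0).isPreconnected with ⟨c, hc⟩ | h
    · exact absurd (fun w hw ↦ hc w hw) (hnc c)
    · exact h _ subset_rfl isOpen_upperHalfPlaneSet
  have hsubset : Ψs '' upperHalfPlaneSet ⊆ U := by
    rw [← hker]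
    refine interior_maximal ?_ hopen
    rintro _ ⟨w, hw, rfl⟩
    exact mem_iInter.2 fun m ↦ ⟨lt_of_lt_of_le hw (him w hw), hmiss w hw m⟩
  exact ⟨Ψs, hΨsd, fun w hw ↦ hsubset ⟨w, hw, rfl⟩, hleft, hinj, him⟩

/-- **Identification of the limit: `d* = d`.** `Φ*` is a conformal map `U → ℍ` with inverse
`Ψ*`; the automorphism `T = Φ* ∘ Φ_A⁻¹` of `ℍ` has boundary value `0` at `0`, and in its normal
form `q C⁻¹(u C z) + p` the case `u ≠ 1` (finite limit at `∞`) is excluded because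
`T⁻¹(is) = Φ_A(Ψ*(is)) → ∞` (`im Ψ*(is) ≥ s`); so `Φ* = q Φ_A`, where `q d = d*` (derivatives
of the reflected extensions at `0`) and `q ≤ 1` (`im Φ* ≤ im`, `Φ_A(iy) ∼ iy`); with `d ≤ d*`
this gives `d* = d`. [folklore] -/
theorem kernel_identification (hA : IsStarHull A) (hΦ : IsRestrictionMap A Φ) (hd : HasRestrictionDeriv A Φ d)
    {r : ℝ} (hr0 : 0 < r) (hr : Disjoint (ball (0 : ℂ) (2 * r)) A) {Φs Gs Ψs : ℂ → ℂ}
    (hGsd : DifferentiableOn ℂ Gs (ball 0 r)) (hGs0 : Gs 0 = 0) {dstar : ℝ} (hGs' : deriv Gs 0 = dstar)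
    (hdd : d ≤ dstar)
    (hΦsd : DifferentiableOn ℂ Φs (upperHalfPlaneSet \ A)) (hΦsm : MapsTo Φs (upperHalfPlaneSet \ A) upperHalfPlaneSet)
    (hinj : InjOn Φs (upperHalfPlaneSet \ A)) (hEq : EqOn Φs Gs (upperHalfPlaneSet ∩ ball 0 r))
    (him : ∀ z ∈ upperHalfPlaneSet \ A, (Φs z).im ≤ z.im)
    (hΨsd : DifferentiableOn ℂ Ψs upperHalfPlaneSet) (hΨsm : MapsTo Ψs upperHalfPlaneSet (upperHalfPlaneSet \ A))
    (hleft : ∀ z ∈ upperHalfPlaneSet \ A, Ψs (Φs z) = z) (hΨinj : InjOn Ψs upperHalfPlaneSet)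
    (hΨim : ∀ w ∈ upperHalfPlaneSet, w.im ≤ (Ψs w).im) : dstar = d := by
  have hUo : IsOpen (upperHalfPlaneSet \ A) := hA.1.isOpen_diff
  -- `Φ* : (upperHalfPlaneSet \ A) → ℍ` is a conformal equivalence with inverse `Ψ*`
  have hright : ∀ w ∈ upperHalfPlaneSet, Φs (Ψs w) = w := fun w hw ↦
    hΨinj (hΦsm (hΨsm hw)) hw (hleft _ (hΨsm hw))
  have hbij : BijOn Φs (upperHalfPlaneSet \ A) upperHalfPlaneSet :=
    ⟨hΦsm, hinj, fun w hw ↦ ⟨Ψs w, hΨsm hw, hright w hw⟩⟩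
  have hinvEq : EqOn (invFunOn Φs (upperHalfPlaneSet \ A)) Ψs upperHalfPlaneSet := fun w hw ↦ by
    have hex : ∃ z ∈ (upperHalfPlaneSet \ A), Φs z = w := ⟨Ψs w, hΨsm hw, hright w hw⟩
    exact hinj (invFunOn_mem hex) (hΨsm hw) ((invFunOn_eq hex).trans (hright w hw).symm)
  have hinvd : DifferentiableOn ℂ (invFunOn Φs (upperHalfPlaneSet \ A)) upperHalfPlaneSet := hΨsd.congr hinvEq
  set E : ConformalEquiv (upperHalfPlaneSet \ A) upperHalfPlaneSet := ConformalEquiv.ofBijOn Φs hΦsd hbij hinvd with hE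
  have hEapp : ∀ z, E z = Φs z := fun z ↦ rfl
  have hEsymm : ∀ w ∈ upperHalfPlaneSet, E.symm w = Ψs w := fun w hw ↦ by
    have h1 : E (E.symm w) = w := E.apply_symm_apply hw
    rw [hEapp] at h1
    exact hinj (E.symm_mapsTo hw) (hΨsm hw) (h1.trans (hright w hw).symm)
  -- the automorphism `T = Φ* ∘ Φ_A⁻¹`
  set T : ConformalEquiv upperHalfPlaneSet upperHalfPlaneSet := Φ.symm.trans E with hT
  have hTapp : ∀ w, T w = Φs (Φ.symm w) := fun w ↦ rfl
  -- boundary value `0` at `0`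
  have hT0 : Tendsto T (𝓝[upperHalfPlaneSet] 0) (𝓝 0) := by
    -- `Φ_A⁻¹ → 0` at `0` (from the model map of `RestrictionMapProofs` and uniqueness)
    obtain ⟨Φ₀, hΦ₀, h00, -, -⟩ := hA.exists_restrictionMap_tendsto
    obtain ⟨Φ₁, -, huniq⟩ := IsStarHull.existsUnique_isRestrictionMap_holds hA
    have hΦeq : EqOn Φ Φ₀ (upperHalfPlaneSet \ A) := fun z hz ↦ by rw [huniq Φ hΦ hz, huniq Φ₀ hΦ₀ hz]
    have hsymm : EqOn Φ.symm Φ₀.symm upperHalfPlaneSet := fun w hw ↦ by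
      have h1 : Φ (Φ.symm w) = Φ₀ (Φ₀.symm w) := by rw [Φ.apply_symm_apply hw, Φ₀.apply_symm_apply hw]
      rw [hΦeq (Φ.symm_mapsTo hw)] at h1
      exact Φ₀.injOn (Φ.symm_mapsTo hw) (Φ₀.symm_mapsTo hw) h1
    have h0 : Tendsto Φ.symm (𝓝[upperHalfPlaneSet] 0) (𝓝 0) :=
      h00.congr' (eventually_nhdsWithin_of_forall fun w hw ↦ (hsymm hw).symm)
    -- eventually `Φ_A⁻¹ w` lies in the upper half-disc, where `Φ* = G*`, continuous at `0`
    have hev : ∀ᶠ w in 𝓝[upperHalfPlaneSet] 0, Φ.symm w ∈ upperHalfPlaneSet ∩ ball (0 : ℂ) r := by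
      have h1 : ∀ᶠ w in 𝓝[upperHalfPlaneSet] 0, Φ.symm w ∈ ball (0 : ℂ) r := h0 (ball_mem_nhds 0 hr0)
      filter_upwards [h1, self_mem_nhdsWithin] with w hw hwH
      exact ⟨(Φ.symm_mapsTo hwH).1, hw⟩
    have hGc : ContinuousAt Gs 0 := (hGsd.differentiableAt (ball_mem_nhds 0 hr0)).continuousAt
    have h2 : Tendsto (fun w ↦ Gs (Φ.symm w)) (𝓝[upperHalfPlaneSet] 0) (𝓝 0) := by
      have := hGc.tendsto.comp h0; rwa [hGs0] at this
    refine h2.congr' ?_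
    filter_upwards [hev] with w hw
    rw [hTapp, hEq hw]
  -- normal form; `u = 1`
  obtain ⟨q, p, hq, u, hu1, hTn⟩ := T.exists_eqOn_normalForm
  have hu : u = 1 := by
    by_contra hu
    -- `z_s = T⁻¹(i(s+1)) → ∞`
    set v : ℕ → ℂ := fun s ↦ I * ((s : ℝ) + 1 : ℝ) with hv
    have hvH : ∀ s, v s ∈ upperHalfPlaneSet := fun s ↦ by
      show 0 < (v s).im; simp [hv]; positivity
    have hvim : ∀ s : ℕ, (v s).im = s + 1 := fun s ↦ by simp [hv]
    set z : ℕ → ℂ := fun s ↦ T.symm (v s) with hz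
    have hzH : ∀ s, z s ∈ upperHalfPlaneSet := fun s ↦ T.symm_mapsTo (hvH s)
    have hzeq : ∀ s, z s = Φ (Ψs (v s)) := fun s ↦ by
      show Φ.symm.symm (E.symm (v s)) = _
      rw [hEsymm _ (hvH s)]
      rfl
    have hΨv : Tendsto (fun s ↦ Ψs (v s)) atTop (cocompact ℂ ⊓ 𝓟 (upperHalfPlaneSet \ A)) := by
      refine tendsto_inf.2 ⟨?_, tendsto_principal.2 (Eventually.of_forall fun s ↦ hΨsm (hvH s))⟩
      rw [← cobounded_eq_cocompact, ← tendsto_norm_atTop_iff_cobounded]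
      refine tendsto_atTop_mono (fun s ↦ ?_) (tendsto_natCast_atTop_atTop.atTop_add tendsto_const_nhds (C := (1 : ℝ)))
      calc (s : ℝ) + 1 = (v s).im := (hvim s).symm
        _ ≤ (Ψs (v s)).im := hΨim _ (hvH s)
        _ ≤ ‖Ψs (v s)‖ := (abs_im_le_norm _).trans' (le_abs_self _)
    have hzco : Tendsto z atTop (cocompact ℂ ⊓ 𝓟 upperHalfPlaneSet) := by
      refine tendsto_inf.2 ⟨?_, tendsto_principal.2 (Eventually.of_forall hzH)⟩
      exact (hΦ.tendsto_cocompact.comp hΨv).congr fun s ↦ (hzeq s).symm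
    set L : ℂ := (q : ℂ) * cayleyInvFun u + p
    have hTL : Tendsto (fun s ↦ T (z s)) atTop (𝓝 L) := by
      have h1 := (ConformalEquiv.tendsto_normalForm_cocompact q p hu).comp (hzco.mono_right inf_le_left)
      exact h1.congr fun s ↦ (hTn (hzH s)).symm
    have hTco : Tendsto (fun s ↦ T (z s)) atTop (cocompact ℂ) := by
      have h1 : Tendsto v atTop (cocompact ℂ) := by
        rw [← cobounded_eq_cocompact, ← tendsto_norm_atTop_iff_cobounded]
        refine tendsto_atTop_mono (fun s ↦ ?_) (tendsto_natCast_atTop_atTop.atTop_add tendsto_const_nhds (C := (1 : ℝ)))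
        calc (s : ℝ) + 1 = (v s).im := (hvim s).symm
          _ ≤ ‖v s‖ := (abs_im_le_norm _).trans' (le_abs_self _)
      exact h1.congr fun s ↦ (T.apply_symm_apply (hvH s)).symm
    exact hTL.not_tendsto (disjoint_nhds_cocompact L) hTco
  subst hu
  have hTq : EqOn T (fun w ↦ (q : ℂ) * w + p) upperHalfPlaneSet := fun w hw ↦ by
    rw [hTn hw]
    simp only [one_mul]
    rw [cayleyInvFun_cayleyFun (add_I_ne_zero (le_of_lt hw))]
  have hp : p = 0 := by
    haveI := neBot_nhdsWithin_upperHalfPlaneSet_zero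
    have hev : (T : ℂ → ℂ) =ᶠ[𝓝[upperHalfPlaneSet] 0] fun w ↦ (q : ℂ) * w + p := eventually_nhdsWithin_of_forall hTq
    have hcont : Tendsto (fun w : ℂ ↦ (q : ℂ) * w + p) (𝓝[upperHalfPlaneSet] 0) (𝓝 ((q : ℂ) * 0 + p)) :=
      (((continuous_const.mul continuous_id).add continuous_const).tendsto 0).mono_left nhdsWithin_le_nhds
    rw [mul_zero, zero_add] at hcont
    have := tendsto_nhds_unique (hcont.congr' hev.symm) hT0
    exact_mod_cast this
  subst hp
  -- `Φ* = q Φ_A` on `(upperHalfPlaneSet \ A)`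
  have hΦsq : ∀ z ∈ (upperHalfPlaneSet \ A), Φs z = (q : ℂ) * Φ z := fun z hz ↦ by
    have h1 := hTq (Φ.mapsTo hz)
    simp only [hTapp, Φ.symm_apply_apply hz, ofReal_zero, add_zero] at h1
    exact h1
  -- `q d = d*` (derivatives of the reflected extensions at `0`)
  have hqd : (q : ℂ) * d = dstar := by
    set GA := reflectExt hA hΦ hr
    have hGAd : DifferentiableOn ℂ GA (ball 0 r) := differentiableOn_reflectExt hA hΦ hr
    set z₁ : ℂ := I * ((r / 2 : ℝ) : ℂ) with hz₁
    have hz₁W : z₁ ∈ upperHalfPlaneSet ∩ ball (0 : ℂ) r := by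
      refine ⟨show 0 < z₁.im by simp [hz₁, hr0], ?_⟩
      rw [mem_ball_zero_iff, hz₁, norm_mul, norm_I, one_mul, norm_real, Real.norm_of_nonneg (by positivity)]
      linarith
    have hWo : IsOpen (upperHalfPlaneSet ∩ ball (0 : ℂ) r) := isOpen_upperHalfPlaneSet.inter isOpen_ball
    have hev : Gs =ᶠ[𝓝 z₁] fun z ↦ (q : ℂ) * GA z := by
      filter_upwards [hWo.mem_nhds hz₁W] with z hz
      rw [← hEq hz, hΦsq z (inter_ball_subset_diff hr hz), show GA z = Φ z from reflectExt_eq hA hΦ hr hz]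
    have hGAq : DifferentiableOn ℂ (fun z ↦ (q : ℂ) * GA z) (ball 0 r) := hGAd.const_mul (q : ℂ)
    have hball : EqOn Gs (fun z ↦ (q : ℂ) * GA z) (ball 0 r) :=
      (hGsd.analyticOnNhd isOpen_ball).eqOn_of_preconnected_of_eventuallyEq (hGAq.analyticOnNhd isOpen_ball)
        (convex_ball _ _).isPreconnected hz₁W.2 hev
    have hev0 : Gs =ᶠ[𝓝 0] fun z ↦ (q : ℂ) * GA z := by
      filter_upwards [isOpen_ball.mem_nhds (mem_ball_self hr0)] with z hz using hball hz
    have h1 := hev0.deriv_eq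
    have hGA0 : DifferentiableAt ℂ GA 0 := hGAd.differentiableAt (ball_mem_nhds 0 hr0)
    rw [hGs', deriv_const_mul _ hGA0, deriv_reflectExt_zero hA hΦ hr hr0 hd] at h1
    exact h1.symm
  have hqd' : q * d = dstar := by exact_mod_cast hqd
  -- `q ≤ 1` (`im Φ* ≤ im` and `Φ_A(iy) ∼ iy`)
  have hq1 : q ≤ 1 := by
    by_contra hq1
    push Not at hq1
    have hlim : Tendsto (fun y : ℝ ↦ (Φ (I * y) / (I * y)).re) atTop (𝓝 1) := by
      have := (continuous_re.tendsto _).comp (hΦ.2.comp (tendsto_I_mul_ofReal_atTop hA.1.1))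
      rw [one_re] at this
      exact this
    have hev1 : ∀ᶠ y : ℝ in atTop, q⁻¹ < (Φ (I * y) / (I * y)).re :=
      (tendsto_order.1 hlim).1 _ (inv_lt_one_of_one_lt₀ hq1)
    have hev2 : ∀ᶠ y : ℝ in atTop, (I * y : ℂ) ∈ (upperHalfPlaneSet \ A) :=
      tendsto_principal.1 (tendsto_inf.1 (tendsto_I_mul_ofReal_atTop (A := A) hA.1.1)).2
    obtain ⟨y, ⟨hy1, hy2⟩, hy0⟩ := ((hev1.and hev2).and (eventually_gt_atTop 0)).exists
    have h1 := him _ hy2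
    rw [hΦsq _ hy2] at h1
    have h2 : ((q : ℂ) * Φ (I * y)).im = q * (Φ (I * y)).im := by simp
    rw [h2, im_eq_mul_re_div_I_mul (Φ (I * y)) hy0.ne'] at h1
    have h3 : (I * (y : ℂ)).im = y := by simp
    rw [h3] at h1
    -- `q * (y * re) ≤ y` with `re > 1/q`: contradiction
    have h4 : q⁻¹ * q = 1 := inv_mul_cancel₀ hq.ne'
    have h5 : y < q * (y * (Φ (I * ↑y) / (I * ↑y)).re) := by
      calc y = q * (y * q⁻¹) := by field_simp
        _ < q * (y * (Φ (I * ↑y) / (I * ↑y)).re) := by gcongr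
    linarith
  -- conclusion
  have hd0 : 0 ≤ d := by
    obtain ⟨d', hd'0, -, hd'⟩ := IsStarHull.exists_hasRestrictionDeriv_holds hA hΦ
    rw [hd.unique hA hd']; exact hd'0.le
  have : dstar ≤ d := by rw [← hqd']; nlinarith
  linarith

/-- **DISCHARGE of the named fact `HasRestrictionDeriv.tendsto_of_kernel`** (continuity of
`Φ'_A(0)` under kernel convergence of increasing hulls; [LSW] proof of Lemma 3.5, p. 12, with the
Carathéodory kernel theorem, here proved by normal families: Montel, Hurwitz, Schwarz reflection
near `0`, the normal form of `Aut(ℍ)`, and the monotonicity of `Φ'_A(0)` in the hull).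
[cite: LawlerSchrammWerner2003Restriction, proof of Lemma 3.5 (p. 12)] -/
theorem HasRestrictionDeriv.tendsto_of_kernel_holds : HasRestrictionDeriv.tendsto_of_kernel := by
  intro A An Φ Φn d dn hA hAn hmono hsub hker hΦ hd hΦn hdn
  obtain ⟨dstar, hdlim, hdd, -, hdpos, -, -⟩ :=
    exists_tendsto_restrictionDeriv_of_monotone hA hAn hmono hsub hΦ hd hΦn hdn
  have hdspos : 0 < dstar := hdpos.trans_le hdd
  obtain ⟨r, hr0, hr⟩ := hA.exists_disjoint_ball
  obtain ⟨φ, Φs, Gs, hφ, hGsd, hGs0, hGs', hΦsd, hΦsm, hΦslim, hEq⟩ :=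
    kernel_extraction hA hAn hsub hΦn hdn hdlim hdspos hr0 hr
  obtain ⟨hinj, -⟩ := kernel_injOn (Φn := Φn) hA hsub hr0 hr hGsd hGs' hdspos hΦslim hEq
  -- a point of `U`
  have hz₀ : I * ((r / 2 : ℝ) : ℂ) ∈ upperHalfPlaneSet \ A := by
    refine inter_ball_subset_diff hr ⟨show 0 < (I * ((r / 2 : ℝ) : ℂ)).im by simp [hr0], ?_⟩
    rw [mem_ball_zero_iff, norm_mul, norm_I, one_mul, norm_real, Real.norm_of_nonneg (by positivity)]
    linarith
  obtain ⟨Ψs, hΨsd, hΨsm, hleft, hΨinj, hΨim⟩ :=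
    kernel_inverse hA hAn hmono hsub hker hΦn hφ hΦsm hΦslim hz₀
  have him : ∀ z ∈ upperHalfPlaneSet \ A, (Φs z).im ≤ z.im := fun z hz ↦
    le_of_tendsto ((continuous_im.tendsto _).comp (hΦslim.tendsto_at hz)) (Eventually.of_forall fun k ↦
      (hΦn (φ k)).im_le_im (hAn _).1.1 ⟨hz.1, fun h ↦ hz.2 (hsub _ h)⟩)
  have := kernel_identification hA hΦ hd hr0 hr hGsd hGs0 hGs' hdd hΦsd hΦsm hinj hEq him hΨsd hΨsm hleft hΨinj hΨim
  rw [← this]; exact hdlim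

end Kernel

end Literature.Probability.RandomPlanarGeometry
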